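import Summits.NavierStokesRegularity.NavierStokesRegularity.Theorems.HodographBetchovFastClassSqueezeStreamStrainAlgebra
import Summits.NavierStokesRegularity.NavierStokesRegularity.Theorems.HodographBetchovClassBudgetsRegulariseSlice

/-!
# Crux `HodographBetchov.FastClassSqueeze` — velocity-truncated enstrophy: the fast-class weighted term

Helper file for the crux item stmt-NavierStokesRegularity-15832 (`FastClassSqueeze`), part of the
VELOCITY-TRUNCATED enstrophy ledger (`…StreamStrainSlice.lean`). With the speed cut-off
`φ = χ(‖v‖²)` (`χ = 1`, `χ' = 0` on `|s| ≤ l²`, `|χ'(s)||s| ≤ D`), `ω = curl v`, `P = ⟪ω, ∇v ω⟫`, the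
production living on the FAST CLASS is `R = −⟪v,ω⟫ χ'(‖v‖²) 2⟪v, ∇v ω⟫ + (1 − φ)(P − 4 det ∇v)`
(shell term + Betchov's fast term). `weighted_term_le`: for a majorant `m ≥ 0` of the
STREAM-DIRECTIONAL STRAIN on the fast class, `‖S(x)v(x)‖ ≤ m(x)‖v(x)‖`, `∫_{l<‖v‖} m^p < ∞`, `p > 3/2`,
`∫ R ≤ (ν/2)∫‖Δv‖² + κ(θ,ν) (2(c‖m1_F‖_p)K_S^{2(1−θ)})^{1/θ} ∫|∇v|²_F`, `c = D‖curl‖² + 1`: pointwise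
`R = 0` on the slow class, `R ≤ 2(c m)|∇v|²_F` on the fast class (`⟪v, ∇v ω⟫ = ⟪Sv, ω⟫`,
`abs_inner_apply_curl_le`; Miller's two-frame lemma `fast_point_bound` via
`two_frame_of_norm_strain_apply_le`), effective weight `G = R⁺/(2|∇v|²_F) ≤ c m 1_F`
(`effWeight_le`), absorption `two_mul_sum_integral_weight_le`.

References: E. Miller, Arch. Ration. Mech. Anal. 235 (2020), Thm. 1.1 / Lemma 5.1 / Thm. 1.3;
R. Betchov, J. Fluid Mech. 1 (1956).
-/

noncomputable section

open MeasureTheory Set Function Filter Topology InnerProductSpace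
open scoped ENNReal NNReal ContDiff RealInnerProductSpace Laplacian

-- the summit and its single sub-problem share the name (CONVENTIONS §1), as in every Theorems file
set_option linter.dupNamespace false

namespace Summit.NavierStokesRegularity.NavierStokesRegularity.Theorems.FastClassSqueeze.StreamStrain

open Literature.Analysis Literature.Analysis.FluidPDE
open Summit.NavierStokesRegularity.NavierStokesRegularity.Theorems.ClassBudgetsRegularise

/-- **Effective-weight division**: if `R ≤ 2 b f` with `b, f ≥ 0` then `R⁺/(2f) ≤ b` (also for
`f = 0`, where the quotient is `0`). The registered helper stub of this file. [folklore] -/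
theorem effWeight_le : ∀ (R f b : ℝ), 0 ≤ b → 0 ≤ f → R ≤ 2 * b * f → max 0 R / (2 * f) ≤ b := by
  intro R f b hb hf hR
  rcases eq_or_lt_of_le hf with h0 | hpos
  · rw [← h0]; simpa using hb
  · rw [div_le_iff₀ (by positivity), max_le_iff]
    exact ⟨by positivity, by linarith⟩

set_option maxHeartbeats 800000 in
/-- **The fast-class weighted term** (module docstring): with a majorant `m ≥ 0` of the
stream-directional strain on the fast class, `∫ R ≤ (ν/2)∫‖Δv‖² + κ (2 (c‖m1_F‖_p) K_S^{2(1−θ)})^{1/θ} ∫|∇v|²_F`.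
[cite: Miller2019, Thm 1.1 (proof of Thm 5.2) and Lemma 5.1] -/
theorem weighted_term_le {ν : ℝ} (hν : 0 < ν)
    {v : EuclideanSpace ℝ (Fin 3) → EuclideanSpace ℝ (Fin 3)} (hv : ContDiff ℝ ∞ v)
    (hdiv : VectorCalculus.IsDivFree v) {K : ℝ} (hK : ∀ x, ‖fderiv ℝ v x‖ ≤ K)
    (hv1 : ∫⁻ x, ‖iteratedFDeriv ℝ 1 v x‖ₑ ^ 2 < ⊤) (hv2 : ∫⁻ x, ‖iteratedFDeriv ℝ 2 v x‖ₑ ^ 2 < ⊤)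
    (hv3 : ∫⁻ x, ‖iteratedFDeriv ℝ 3 v x‖ₑ ^ 2 < ⊤)
    {l : ℝ} (hl : 0 < l)
    {χ : ℝ → ℝ} (hχc : Continuous χ) (hχ'c : Continuous (deriv χ)) (hχ01 : ∀ s, 0 ≤ χ s ∧ χ s ≤ 1)
    (hχ1 : ∀ s, |s| ≤ l ^ 2 → χ s = 1) (hχd0 : ∀ s, |s| ≤ l ^ 2 → deriv χ s = 0)
    {D : ℝ} (hD0 : 0 ≤ D) (hχD : ∀ s, |deriv χ s| * |s| ≤ D)
    {m : EuclideanSpace ℝ (Fin 3) → ℝ} (hm0 : ∀ x, 0 ≤ m x)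
    (hdir : ∀ x, l < ‖v x‖ →
      ‖((1 / 2 : ℝ) • (fderiv ℝ v x + ContinuousLinearMap.adjoint (fderiv ℝ v x))) (v x)‖ ≤
        m x * ‖v x‖)
    {p : ℝ} (hp : 3 / 2 < p)
    (hmp : ∫⁻ x in {x | l < ‖v x‖}, ENNReal.ofReal (m x) ^ p < ⊤) :
    ∫ x, (-(⟪v x, curl v x⟫ * (deriv χ (‖v x‖ ^ 2) * (2 * ⟪v x, fderiv ℝ v x (curl v x)⟫))) +
        (1 - χ (‖v x‖ ^ 2)) * (⟪curl v x, fderiv ℝ v x (curl v x)⟫ - 4 * (fderiv ℝ v x).det)) ≤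
      ν / 2 * (∫ x, ‖(Δ v) x‖ ^ 2) +
        (1 - 3 / (2 * p)) * (2 * (1 - (1 - 3 / (2 * p)))) ^ ((1 - (1 - 3 / (2 * p))) / (1 - 3 / (2 * p))) *
          ν ^ (-((1 - (1 - 3 / (2 * p))) / (1 - 3 / (2 * p)))) *
          (2 * ((D * ‖curlCLM‖ ^ 2 + 1) *
              ((∫⁻ x in {x | l < ‖v x‖}, ENNReal.ofReal (m x) ^ p) ^ (1 / p)).toReal) *
            ((SNormLESNormFDerivOfEqConst (EuclideanSpace ℝ (Fin 3))
              (volume : Measure (EuclideanSpace ℝ (Fin 3))) 2 : ℝ) ^ (2 * (1 - (1 - 3 / (2 * p)))))) ^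
            (1 / (1 - 3 / (2 * p))) *
          ∫ x, frobeniusNormSq (fderiv ℝ v x) := by
  set e := EuclideanSpace.basisFun (Fin 3) ℝ with he
  set KS : ℝ := (SNormLESNormFDerivOfEqConst (EuclideanSpace ℝ (Fin 3))
    (volume : Measure (EuclideanSpace ℝ (Fin 3))) 2 : ℝ) with hKS
  set θ : ℝ := 1 - 3 / (2 * p) with hθ
  set cω : ℝ := ‖curlCLM‖ with hcω
  set c : ℝ := D * cω ^ 2 + 1 with hc
  have hp0 : 0 < p := by linarith
  have hθ0 : 0 < θ := by
    rw [hθ, sub_pos, div_lt_one (by positivity)]; linarith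
  have hθ1 : θ < 1 := by
    rw [hθ]; linarith [div_pos (zero_lt_three' ℝ) (by positivity : (0 : ℝ) < 2 * p)]
  have hKS0 : 0 ≤ KS := NNReal.coe_nonneg _
  have hcω0 : 0 ≤ cω := by rw [hcω]; exact norm_nonneg curlCLM
  have hc0 : 0 ≤ c := by positivity
  have hK0 : 0 ≤ K := (norm_nonneg _).trans (hK 0)
  have hv3' : ContDiff ℝ 3 v := hv.of_le (by norm_cast)
  have hv2' : ContDiff ℝ 2 v := hv.of_le (by norm_cast)
  have hv1' : ContDiff ℝ 1 v := hv.of_le (by norm_cast)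
  have hdv : ∀ x, DifferentiableAt ℝ v x := fun x => (hv1'.differentiable one_ne_zero) x
  have hdiv' : ∀ x, VectorCalculus.divergence v x = 0 := hdiv
  have hω1 : ContDiff ℝ 1 (curl v) := contDiff_curl (n := 1) (by exact_mod_cast hv2')
  have cv : Continuous v := hv.continuous
  have cDv : Continuous (fderiv ℝ v) := hv1'.continuous_fderiv one_ne_zero
  have ccurl : Continuous (curl v) := hω1.continuous
  set F : Set (EuclideanSpace ℝ (Fin 3)) := {x | l < ‖v x‖} with hF
  have hFm : MeasurableSet F := (isOpen_lt continuous_const cv.norm).measurableSet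
  set φ : EuclideanSpace ℝ (Fin 3) → ℝ := fun x => χ (‖v x‖ ^ 2) with hφ
  have hφ01 : ∀ x, 0 ≤ φ x ∧ φ x ≤ 1 := fun x => hχ01 _
  have habs : ∀ x, |‖v x‖ ^ 2| = ‖v x‖ ^ 2 := fun x => abs_of_nonneg (sq_nonneg _)
  have hslow_sq : ∀ x, ‖v x‖ ≤ l → |‖v x‖ ^ 2| ≤ l ^ 2 := fun x hx => by
    rw [habs]; exact pow_le_pow_left₀ (norm_nonneg _) hx 2
  have hφS : ∀ x, ‖v x‖ ≤ l → φ x = 1 := fun x hx => hχ1 _ (hslow_sq x hx)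
  have hχ'S : ∀ x, ‖v x‖ ≤ l → deriv χ (‖v x‖ ^ 2) = 0 := fun x hx => hχd0 _ (hslow_sq x hx)
  have hDv_eq : ∀ x, ‖fderiv ℝ v x‖ = ‖iteratedFDeriv ℝ 1 v x‖ := fun x => by
    rw [← norm_iteratedFDeriv_fderiv, norm_iteratedFDeriv_zero]
  have l2Dv : ∫⁻ x, ‖fderiv ℝ v x‖ₑ ^ 2 < ⊤ := lintegral_enorm_sq_lt_top_of_norm_le (fun x => (hDv_eq x).le) hv1
  have hfrob_int : Integrable (fun x => frobeniusNormSq (fderiv ℝ v x)) volume := by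
    have lfrob : ∫⁻ x, ENNReal.ofReal (FluidPDE.frobeniusNormSq (fderiv ℝ v x)) < ⊤ :=
      calc ∫⁻ x, ENNReal.ofReal (FluidPDE.frobeniusNormSq (fderiv ℝ v x))
          ≤ ∫⁻ x, 3 * ‖fderiv ℝ v x‖ₑ ^ 2 := lintegral_mono fun x => ofReal_frobeniusNormSq_le_three_mul_enorm_sq _
        _ = 3 * ∫⁻ x, ‖fderiv ℝ v x‖ₑ ^ 2 := lintegral_const_mul' _ _ (by norm_num)
        _ < ⊤ := ENNReal.mul_lt_top (by norm_num) l2Dv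
    exact integrable_of_continuous_of_nonneg (FluidPDE.continuous_frobeniusNormSq_fderiv hv (by simp))
      (fun x => FluidPDE.frobeniusNormSq_nonneg _) lfrob
  have hω_le : ∀ x, ‖curl v x‖ ≤ cω * ‖fderiv ℝ v x‖ := fun x => norm_curl_le v x
  have hsq : ∀ x, ‖fderiv ℝ v x‖ ^ 2 ≤ frobeniusNormSq (fderiv ℝ v x) := fun x =>
    FluidPDE.sq_opNorm_le_frobeniusNormSq _
  have hω_sq : ∀ x, ‖curl v x‖ ^ 2 ≤ cω ^ 2 * frobeniusNormSq (fderiv ℝ v x) := fun x =>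
    calc ‖curl v x‖ ^ 2 ≤ (cω * ‖fderiv ℝ v x‖) ^ 2 := pow_le_pow_left₀ (norm_nonneg _) (hω_le x) 2
      _ = cω ^ 2 * ‖fderiv ℝ v x‖ ^ 2 := by ring
      _ ≤ cω ^ 2 * frobeniusNormSq (fderiv ℝ v x) := mul_le_mul_of_nonneg_left (hsq x) (sq_nonneg _)
  have cP : Continuous fun x => ⟪curl v x, fderiv ℝ v x (curl v x)⟫ := ccurl.inner (cDv.clm_apply ccurl)
  have cdet : Continuous fun x => (fderiv ℝ v x).det := ContinuousLinearMap.continuous_det.comp cDv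
  have cfrob : Continuous fun x => frobeniusNormSq (fderiv ℝ v x) := FluidPDE.continuous_frobeniusNormSq_fderiv hv (by simp)
  have cφ : Continuous φ := hχc.comp (cv.norm.pow 2)
  have cχ' : Continuous fun y => deriv χ (‖v y‖ ^ 2) := hχ'c.comp (cv.norm.pow 2)
  have hdet_le : ∀ x, |(fderiv ℝ v x).det| ≤ (1 / 2) * K * frobeniusNormSq (fderiv ℝ v x) := fun x =>
    (abs_det_fderiv_le (hdv x)).trans (by
      gcongr
      · exact frobeniusNormSq_nonneg _
      · exact hK x)
  have hP_le : ∀ x, |⟪curl v x, fderiv ℝ v x (curl v x)⟫| ≤ cω ^ 2 * K * frobeniusNormSq (fderiv ℝ v x) := by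
    intro x
    calc |⟪curl v x, fderiv ℝ v x (curl v x)⟫| ≤ ‖curl v x‖ * ‖fderiv ℝ v x (curl v x)‖ := abs_real_inner_le_norm _ _
      _ ≤ ‖curl v x‖ * (‖fderiv ℝ v x‖ * ‖curl v x‖) := by gcongr; exact (fderiv ℝ v x).le_opNorm _
      _ = ‖fderiv ℝ v x‖ * ‖curl v x‖ ^ 2 := by ring
      _ ≤ K * (cω ^ 2 * frobeniusNormSq (fderiv ℝ v x)) := mul_le_mul (hK x) (hω_sq x) (sq_nonneg _) hK0
      _ = cω ^ 2 * K * frobeniusNormSq (fderiv ℝ v x) := by ring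
  have idet : Integrable (fun x => (fderiv ℝ v x).det) volume := by
    refine Integrable.mono' (hfrob_int.const_mul ((1 / 2) * K)) cdet.aestronglyMeasurable
      (Eventually.of_forall fun x => ?_)
    rw [Real.norm_eq_abs]; exact hdet_le x
  have iP : Integrable (fun x => ⟪curl v x, fderiv ℝ v x (curl v x)⟫) volume := by
    refine Integrable.mono' (hfrob_int.const_mul (cω ^ 2 * K)) cP.aestronglyMeasurable
      (Eventually.of_forall fun x => ?_)
    rw [Real.norm_eq_abs]; exact hP_le x
  have iφP : Integrable (fun x => φ x * ⟪curl v x, fderiv ℝ v x (curl v x)⟫) volume := by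
    refine Integrable.mono' iP.norm (cφ.mul cP).aestronglyMeasurable (Eventually.of_forall fun x => ?_)
    rw [norm_mul, Real.norm_eq_abs, abs_of_nonneg (hφ01 x).1]
    exact mul_le_of_le_one_left (norm_nonneg _) (hφ01 x).2
  have iφdet : Integrable (fun x => φ x * (fderiv ℝ v x).det) volume := by
    refine Integrable.mono' idet.norm (cφ.mul cdet).aestronglyMeasurable (Eventually.of_forall fun x => ?_)
    rw [norm_mul, Real.norm_eq_abs, abs_of_nonneg (hφ01 x).1]
    exact mul_le_of_le_one_left (norm_nonneg _) (hφ01 x).2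
  -- Step 4: the weighted part `R = −⟪v,ω⟫ χ' 2⟪v, ∇v ω⟫ + (1 − φ)(P − 4 det)` and its effective weight
  set Rb : EuclideanSpace ℝ (Fin 3) → ℝ := fun x =>
    ⟪v x, curl v x⟫ * (deriv χ (‖v x‖ ^ 2) * (2 * ⟪v x, fderiv ℝ v x (curl v x)⟫)) with hRb
  set R : EuclideanSpace ℝ (Fin 3) → ℝ := fun x =>
    -Rb x + (1 - φ x) * (⟪curl v x, fderiv ℝ v x (curl v x)⟫ - 4 * (fderiv ℝ v x).det) with hR
  set G : EuclideanSpace ℝ (Fin 3) → ℝ := fun x => max 0 (R x) / (2 * frobeniusNormSq (fderiv ℝ v x))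
    with hG
  set MG : ℝ := (2 * D * cω ^ 2 + cω ^ 2 + 2) * K / 2 with hMG
  have cRb : Continuous Rb := (cv.inner ccurl).mul (cχ'.mul ((cv.inner (cDv.clm_apply ccurl)).const_mul 2))
  have cR : Continuous R := cRb.neg.add ((continuous_const.sub cφ).mul (cP.sub (continuous_const.mul cdet)))
  have hGm : Measurable G := ((continuous_const.max cR).measurable).div ((continuous_const.mul cfrob).measurable)
  have hG0 : ∀ x, 0 ≤ G x := fun x =>
    div_nonneg (le_max_left _ _) (mul_nonneg zero_le_two (frobeniusNormSq_nonneg _))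
  -- the shell bound `|Rb| ≤ 2 |χ'(s)| s ‖A‖ ‖ω‖²`, and with the directional majorant on the fast class
  have hRb_abs : ∀ x, |Rb x| ≤ 2 * (|deriv χ (‖v x‖ ^ 2)| * ‖v x‖ ^ 2) * ‖fderiv ℝ v x‖ * ‖curl v x‖ ^ 2 := by
    intro x
    rw [hRb]; dsimp only
    rw [abs_mul, abs_mul, abs_mul, abs_two]
    calc |⟪v x, curl v x⟫| * (|deriv χ (‖v x‖ ^ 2)| * (2 * |⟪v x, fderiv ℝ v x (curl v x)⟫|))
        ≤ (‖v x‖ * ‖curl v x‖) * (|deriv χ (‖v x‖ ^ 2)| * (2 * (‖v x‖ * (‖fderiv ℝ v x‖ * ‖curl v x‖)))) := by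
          gcongr
          · exact abs_real_inner_le_norm _ _
          · exact (abs_real_inner_le_norm _ _).trans
              (mul_le_mul_of_nonneg_left ((fderiv ℝ v x).le_opNorm _) (norm_nonneg _))
      _ = 2 * (|deriv χ (‖v x‖ ^ 2)| * ‖v x‖ ^ 2) * ‖fderiv ℝ v x‖ * ‖curl v x‖ ^ 2 := by ring
  have hχs : ∀ x, |deriv χ (‖v x‖ ^ 2)| * ‖v x‖ ^ 2 ≤ D := fun x => by
    have h := hχD (‖v x‖ ^ 2); rwa [habs] at h
  have hRb_F : ∀ x, l < ‖v x‖ → |Rb x| ≤ 2 * D * cω ^ 2 * m x * frobeniusNormSq (fderiv ℝ v x) := by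
    intro x hx
    rw [hRb]; dsimp only
    rw [abs_mul, abs_mul, abs_mul, abs_two]
    have hdirx := hdir x hx
    have hSv : |⟪v x, fderiv ℝ v x (curl v x)⟫| ≤ m x * ‖v x‖ * ‖curl v x‖ :=
      (abs_inner_apply_curl_le v x (v x)).trans (mul_le_mul_of_nonneg_right hdirx (norm_nonneg _))
    calc |⟪v x, curl v x⟫| * (|deriv χ (‖v x‖ ^ 2)| * (2 * |⟪v x, fderiv ℝ v x (curl v x)⟫|))
        ≤ (‖v x‖ * ‖curl v x‖) * (|deriv χ (‖v x‖ ^ 2)| * (2 * (m x * ‖v x‖ * ‖curl v x‖))) := by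
          gcongr
          exact abs_real_inner_le_norm _ _
      _ = 2 * (|deriv χ (‖v x‖ ^ 2)| * ‖v x‖ ^ 2) * m x * ‖curl v x‖ ^ 2 := by ring
      _ ≤ 2 * D * m x * (cω ^ 2 * frobeniusNormSq (fderiv ℝ v x)) := by
          have := hm0 x
          gcongr
          · exact hχs x
          · exact hω_sq x
      _ = 2 * D * cω ^ 2 * m x * frobeniusNormSq (fderiv ℝ v x) := by ring
  -- `R = 0` on the slow class, `R ≤ 2 (c m) |∇v|²_F` on the fast class, `R ≤ 2 MG |∇v|²_F` everywhere
  have hR_S : ∀ x, ‖v x‖ ≤ l → R x = 0 := by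
    intro x hx
    rw [hR]; dsimp only
    rw [hRb]; dsimp only
    rw [hφS x hx, hχ'S x hx]; ring
  have hfast_pt : ∀ x, l < ‖v x‖ →
      ⟪curl v x, fderiv ℝ v x (curl v x)⟫ - 4 * (fderiv ℝ v x).det ≤ 2 * m x * frobeniusNormSq (fderiv ℝ v x) := by
    intro x hx
    have hvx : v x ≠ 0 := by
      intro h; rw [h, norm_zero] at hx; exact absurd hx (not_lt.2 hl.le)
    exact fast_point_bound v x (hdiv' x) (m x) (hm0 x)
      (two_frame_of_norm_strain_apply_le (hdiv' x) hvx (hdir x hx))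
  have hR_F : ∀ x, l < ‖v x‖ → R x ≤ 2 * (c * m x) * frobeniusNormSq (fderiv ℝ v x) := by
    intro x hx
    have h1 : -Rb x ≤ 2 * D * cω ^ 2 * m x * frobeniusNormSq (fderiv ℝ v x) := (neg_le_abs _).trans (hRb_F x hx)
    have h2 : (1 - φ x) * (⟪curl v x, fderiv ℝ v x (curl v x)⟫ - 4 * (fderiv ℝ v x).det) ≤
        2 * m x * frobeniusNormSq (fderiv ℝ v x) := by
      have h1φ : 0 ≤ 1 - φ x := by linarith [(hφ01 x).2]
      have h1φ' : 1 - φ x ≤ 1 := by linarith [(hφ01 x).1]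
      have hrhs : 0 ≤ 2 * m x * frobeniusNormSq (fderiv ℝ v x) :=
        mul_nonneg (mul_nonneg zero_le_two (hm0 x)) (frobeniusNormSq_nonneg _)
      rcases le_or_gt 0 (⟪curl v x, fderiv ℝ v x (curl v x)⟫ - 4 * (fderiv ℝ v x).det) with hpos | hneg
      · exact (mul_le_of_le_one_left hpos h1φ').trans (hfast_pt x hx)
      · exact (mul_nonpos_iff.2 (Or.inl ⟨h1φ, hneg.le⟩)).trans hrhs
    rw [hR]; dsimp only
    rw [hc]
    nlinarith [h1, h2]
  have hR_MG : ∀ x, R x ≤ 2 * MG * frobeniusNormSq (fderiv ℝ v x) := by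
    intro x
    have h1 : -Rb x ≤ 2 * D * cω ^ 2 * K * frobeniusNormSq (fderiv ℝ v x) := by
      refine (neg_le_abs _).trans ((hRb_abs x).trans ?_)
      calc 2 * (|deriv χ (‖v x‖ ^ 2)| * ‖v x‖ ^ 2) * ‖fderiv ℝ v x‖ * ‖curl v x‖ ^ 2
          ≤ 2 * D * K * (cω ^ 2 * frobeniusNormSq (fderiv ℝ v x)) := by
            gcongr
            · exact hχs x
            · exact hK x
            · exact hω_sq x
        _ = 2 * D * cω ^ 2 * K * frobeniusNormSq (fderiv ℝ v x) := by ring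
    have h2 : (1 - φ x) * (⟪curl v x, fderiv ℝ v x (curl v x)⟫ - 4 * (fderiv ℝ v x).det) ≤
        (cω ^ 2 * K + 2 * K) * frobeniusNormSq (fderiv ℝ v x) := by
      have h1φ : 0 ≤ 1 - φ x := by linarith [(hφ01 x).2]
      have h1φ' : 1 - φ x ≤ 1 := by linarith [(hφ01 x).1]
      have hb : |⟪curl v x, fderiv ℝ v x (curl v x)⟫ - 4 * (fderiv ℝ v x).det| ≤
          (cω ^ 2 * K + 2 * K) * frobeniusNormSq (fderiv ℝ v x) := by
        calc |⟪curl v x, fderiv ℝ v x (curl v x)⟫ - 4 * (fderiv ℝ v x).det|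
            ≤ |⟪curl v x, fderiv ℝ v x (curl v x)⟫| + |4 * (fderiv ℝ v x).det| := abs_sub _ _
          _ ≤ cω ^ 2 * K * frobeniusNormSq (fderiv ℝ v x) + 4 * ((1 / 2) * K * frobeniusNormSq (fderiv ℝ v x)) := by
              rw [abs_mul, abs_of_pos (by norm_num : (0 : ℝ) < 4)]
              exact add_le_add (hP_le x) (mul_le_mul_of_nonneg_left (hdet_le x) (by norm_num))
          _ = (cω ^ 2 * K + 2 * K) * frobeniusNormSq (fderiv ℝ v x) := by ring
      calc (1 - φ x) * (⟪curl v x, fderiv ℝ v x (curl v x)⟫ - 4 * (fderiv ℝ v x).det)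
          ≤ (1 - φ x) * |⟪curl v x, fderiv ℝ v x (curl v x)⟫ - 4 * (fderiv ℝ v x).det| :=
            mul_le_mul_of_nonneg_left (le_abs_self _) h1φ
        _ ≤ 1 * ((cω ^ 2 * K + 2 * K) * frobeniusNormSq (fderiv ℝ v x)) :=
            mul_le_mul h1φ' hb (abs_nonneg _) zero_le_one
        _ = (cω ^ 2 * K + 2 * K) * frobeniusNormSq (fderiv ℝ v x) := one_mul _
    rw [hR]; dsimp only
    rw [hMG]
    nlinarith [h1, h2]
  have hMG0 : 0 ≤ MG := by positivity
  have hG_frob : ∀ x, R x ≤ 2 * G x * frobeniusNormSq (fderiv ℝ v x) := by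
    intro x
    rcases eq_or_lt_of_le (frobeniusNormSq_nonneg (fderiv ℝ v x)) with h0 | hpos
    · -- `∇v(x) = 0`: everything vanishes
      have hA0 : fderiv ℝ v x = 0 := (frobeniusNormSq_eq_zero_iff _).1 h0.symm
      have hω0 : curl v x = 0 := by rw [curl_eq_curlCLM, hA0, map_zero]
      have hR0 : R x = 0 := by
        rw [hR]; dsimp only
        rw [hRb]; dsimp only
        rw [hω0, det_eq_entries (fderiv ℝ v x), hA0]
        simp
      rw [hR0, ← h0]; simp
    · have key : 2 * (max 0 (R x) / (2 * frobeniusNormSq (fderiv ℝ v x))) * frobeniusNormSq (fderiv ℝ v x) =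
          max 0 (R x) := by
        field_simp
      rw [hG]; dsimp only
      rw [key]
      exact le_max_right _ _
  have hG_div : ∀ x {b : ℝ}, 0 ≤ b → R x ≤ 2 * b * frobeniusNormSq (fderiv ℝ v x) → G x ≤ b :=
    fun x b hb hRle => effWeight_le _ _ _ hb (frobeniusNormSq_nonneg _) hRle
  have hGM : ∀ x, G x ≤ MG := fun x => hG_div x hMG0 (hR_MG x)
  have hGF : ∀ x ∈ F, G x ≤ c * m x := fun x hx => hG_div x (mul_nonneg hc0 (hm0 x)) (hR_F x hx)
  have hGS : ∀ x, x ∉ F → G x = 0 := by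
    intro x hx
    have hx' : ‖v x‖ ≤ l := not_lt.1 hx
    rw [hG]; dsimp only
    rw [hR_S x hx', max_self, zero_div]
  -- `∫ G^p ≤ c^p ∫_F m^p < ∞` and `‖G‖_p ≤ c ‖m 1_F‖_p`
  have hGind : ∀ x, ENNReal.ofReal (G x) ^ p = F.indicator (fun x => ENNReal.ofReal (G x) ^ p) x := by
    intro x
    by_cases hx : x ∈ F
    · rw [indicator_of_mem hx]
    · rw [indicator_of_notMem hx, hGS x hx, ENNReal.ofReal_zero, ENNReal.zero_rpow_of_pos hp0]
  have hGp_le : ∫⁻ x, ENNReal.ofReal (G x) ^ p ≤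
      ENNReal.ofReal c ^ p * ∫⁻ x in F, ENNReal.ofReal (m x) ^ p := by
    calc ∫⁻ x, ENNReal.ofReal (G x) ^ p = ∫⁻ x in F, ENNReal.ofReal (G x) ^ p := by
          rw [← lintegral_indicator hFm]
          exact lintegral_congr hGind
      _ ≤ ∫⁻ x in F, ENNReal.ofReal c ^ p * ENNReal.ofReal (m x) ^ p := by
          refine setLIntegral_mono' hFm fun x hx => ?_
          rw [← ENNReal.mul_rpow_of_nonneg _ _ hp0.le, ← ENNReal.ofReal_mul hc0]
          exact ENNReal.rpow_le_rpow (ENNReal.ofReal_le_ofReal (hGF x hx)) hp0.le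
      _ = ENNReal.ofReal c ^ p * ∫⁻ x in F, ENNReal.ofReal (m x) ^ p :=
          lintegral_const_mul' _ _ (ENNReal.rpow_ne_top_of_nonneg hp0.le ENNReal.ofReal_ne_top)
  have hGp : ∫⁻ x, ENNReal.ofReal (G x) ^ p < ⊤ :=
    lt_of_le_of_lt hGp_le (ENNReal.mul_lt_top
      (ENNReal.rpow_lt_top_of_nonneg hp0.le ENNReal.ofReal_ne_top) hmp)
  set NG : ℝ := ((∫⁻ x, ENNReal.ofReal (G x) ^ p) ^ (1 / p)).toReal with hNG
  set Nm : ℝ := ((∫⁻ x in F, ENNReal.ofReal (m x) ^ p) ^ (1 / p)).toReal with hNm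
  have hNG0 : 0 ≤ NG := ENNReal.toReal_nonneg
  have hNm0 : 0 ≤ Nm := ENNReal.toReal_nonneg
  have hNGm : NG ≤ c * Nm := by
    rw [hNG, hNm]
    have h1 : (∫⁻ x, ENNReal.ofReal (G x) ^ p) ^ (1 / p) ≤
        ENNReal.ofReal c * (∫⁻ x in F, ENNReal.ofReal (m x) ^ p) ^ (1 / p) := by
      calc (∫⁻ x, ENNReal.ofReal (G x) ^ p) ^ (1 / p)
          ≤ (ENNReal.ofReal c ^ p * ∫⁻ x in F, ENNReal.ofReal (m x) ^ p) ^ (1 / p) :=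
            ENNReal.rpow_le_rpow hGp_le (by positivity)
        _ = ENNReal.ofReal c * (∫⁻ x in F, ENNReal.ofReal (m x) ^ p) ^ (1 / p) := by
            rw [ENNReal.mul_rpow_of_nonneg _ _ (by positivity), ← ENNReal.rpow_mul,
              mul_one_div_cancel hp0.ne', ENNReal.rpow_one]
    have hfin : ENNReal.ofReal c * (∫⁻ x in F, ENNReal.ofReal (m x) ^ p) ^ (1 / p) ≠ ⊤ :=
      ENNReal.mul_ne_top ENNReal.ofReal_ne_top (ENNReal.rpow_ne_top_of_nonneg (by positivity) hmp.ne)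
    have h2 := ENNReal.toReal_mono hfin h1
    rwa [ENNReal.toReal_mul, ENNReal.toReal_ofReal hc0] at h2
  -- Step 5: `∫ R ≤ 2 Σⱼ ∫ G ‖∂ⱼv‖² ≤ (ν/2) ∫‖Δv‖² + κ‖G‖_p^{1/θ} ∫|∇v|²_F`
  have iRb : Integrable Rb volume := by
    refine Integrable.mono' (hfrob_int.const_mul (2 * D * cω ^ 2 * K)) cRb.aestronglyMeasurable
      (Eventually.of_forall fun x => ?_)
    rw [Real.norm_eq_abs]
    refine (hRb_abs x).trans ?_
    calc 2 * (|deriv χ (‖v x‖ ^ 2)| * ‖v x‖ ^ 2) * ‖fderiv ℝ v x‖ * ‖curl v x‖ ^ 2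
        ≤ 2 * D * K * (cω ^ 2 * frobeniusNormSq (fderiv ℝ v x)) := by
          gcongr
          · exact hχs x
          · exact hK x
          · exact hω_sq x
      _ = 2 * D * cω ^ 2 * K * frobeniusNormSq (fderiv ℝ v x) := by ring
  have iFast : Integrable (fun x => (1 - φ x) * (⟪curl v x, fderiv ℝ v x (curl v x)⟫ - 4 * (fderiv ℝ v x).det))
      volume :=
    ((iP.sub iφP).sub ((idet.sub iφdet).const_mul 4)).congr
      (Eventually.of_forall fun x => by simp only [Pi.sub_apply]; ring)
  have iRR : Integrable R volume := by
    have : R = fun x => -Rb x + (1 - φ x) * (⟪curl v x, fderiv ℝ v x (curl v x)⟫ - 4 * (fderiv ℝ v x).det) := rfl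
    rw [this]
    exact iRb.neg.add iFast
  have iGf : Integrable (fun x => 2 * G x * frobeniusNormSq (fderiv ℝ v x)) volume := by
    refine Integrable.mono' (hfrob_int.const_mul (2 * MG))
      (((measurable_const.mul hGm).aestronglyMeasurable).mul cfrob.aestronglyMeasurable)
      (Eventually.of_forall fun x => ?_)
    rw [Real.norm_of_nonneg (by have := hG0 x; have := frobeniusNormSq_nonneg (fderiv ℝ v x); positivity)]
    have := frobeniusNormSq_nonneg (fderiv ℝ v x)
    gcongr
    exact hGM x
  have hR1 : ∫ x, R x ≤ ∫ x, 2 * G x * frobeniusNormSq (fderiv ℝ v x) := integral_mono iRR iGf hG_frob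
  have cdiv : ∀ j, Continuous fun x => fderiv ℝ v x (e j) := fun j => cDv.clm_apply continuous_const
  have l2div : ∀ j, ∫⁻ x, ‖fderiv ℝ v x (e j)‖ₑ ^ 2 < ⊤ := fun j =>
    lintegral_enorm_sq_lt_top_of_norm_le (fun x => by
      simpa [he] using (fderiv ℝ v x).le_opNorm (e j)) l2Dv
  have i_a : ∀ j, Integrable (fun x => ‖fderiv ℝ v x (e j)‖ ^ 2) volume := fun j =>
    FluidPDE.integrable_sq_norm_of_lintegral_lt_top (cdiv j) (l2div j)
  have i_Ga : ∀ j, Integrable (fun x => G x * ‖fderiv ℝ v x (e j)‖ ^ 2) volume := by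
    intro j
    refine Integrable.mono' ((i_a j).const_mul MG)
      (hGm.aestronglyMeasurable.mul ((cdiv j).norm.pow 2).aestronglyMeasurable)
      (Eventually.of_forall fun x => ?_)
    rw [Real.norm_of_nonneg (mul_nonneg (hG0 x) (sq_nonneg _))]
    exact mul_le_mul_of_nonneg_right (hGM x) (sq_nonneg _)
  have hR2 : ∫ x, 2 * G x * frobeniusNormSq (fderiv ℝ v x) =
      2 * ∑ j, ∫ x, G x * ‖fderiv ℝ v x (e j)‖ ^ 2 := by
    rw [← integral_finsetSum _ fun j _ => i_Ga j, ← integral_const_mul]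
    refine integral_congr_ae (Eventually.of_forall fun x => ?_)
    simp only
    rw [FluidPDE.frobeniusNormSq_eq_sum e, Finset.mul_sum, Finset.mul_sum]
    refine Finset.sum_congr rfl fun j _ => ?_
    ring
  have habs := two_mul_sum_integral_weight_le hν hv3' hv1 hv2 hv3 hGm hG0 hGM hp hGp
  have hΔ0 : 0 ≤ ∫ x, ‖(Δ v) x‖ ^ 2 := integral_nonneg fun x => sq_nonneg _
  have hfrob0 : 0 ≤ ∫ x, frobeniusNormSq (fderiv ℝ v x) := integral_nonneg fun x => FluidPDE.frobeniusNormSq_nonneg _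
  have h1θ : 0 < 1 - θ := by linarith
  have hCθ0 : 0 ≤ θ * (2 * (1 - θ)) ^ ((1 - θ) / θ) * ν ^ (-((1 - θ) / θ)) := by positivity
  have hmonoN : (2 * NG * KS ^ (2 * (1 - θ))) ^ (1 / θ) ≤ (2 * (c * Nm) * KS ^ (2 * (1 - θ))) ^ (1 / θ) := by
    refine Real.rpow_le_rpow (by positivity) ?_ (by positivity)
    gcongr
  have hRtot : ∫ x, R x ≤ ν / 2 * (∫ x, ‖(Δ v) x‖ ^ 2) +
      θ * (2 * (1 - θ)) ^ ((1 - θ) / θ) * ν ^ (-((1 - θ) / θ)) *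
        (2 * (c * Nm) * KS ^ (2 * (1 - θ))) ^ (1 / θ) * ∫ x, frobeniusNormSq (fderiv ℝ v x) := by
    refine (hR1.trans_eq hR2).trans (habs.trans ?_)
    gcongr
  exact hRtot

end Summit.NavierStokesRegularity.NavierStokesRegularity.Theorems.FastClassSqueeze.StreamStrain

end
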